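import Literature.AlgebraicGeometry.Motives.MixedHodgeStructureTensorDeligneI
import Literature.AlgebraicGeometry.Motives.MixedHodgeStructureEndBigrading
import HarnessLib

/-!
# Tensor products of endomorphisms of complexified Hodge structures: `A ⊗ B` on `(V ⊗ V')_ℂ`

Cattani–El Zein–Griffiths–Lê, *Hodge Theory* (Math. Notes 49), §3.2.2.7 (1) defines the tensor product of
mixed Hodge structures by "the general rules of filtrations" — `W_r(H ⊗ H') = Σ_{p+p'=r} W_p ⊗ W_{p'}`,
`F^r(H ⊗ H') = Σ F^p ⊗ F^{p'}` (Deligne, *Hodge II*, (1.1.12): "`⊗` est un foncteur … de la catégorie des objets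
filtrés", i.e. `f ⊗ g` respects the tensor filtrations when `f`, `g` respect the factors') — and Thm. 7.5.6
(Deligne's bigrading `I^{p,q}`) is "functorial and compatible with tensor products": with (7.6.2),
`𝔤𝔩(V)^{a,b} = {X : X(I^{p,q}) ⊂ I^{p+a,q+b}}`, an endomorphism `A ∈ 𝔤𝔩(V)^{a,b}`, `B ∈ 𝔤𝔩(V')^{c,d}` gives
`A ⊗ B ∈ 𝔤𝔩(V ⊗ V')^{a+c,b+d}`. The tree realizes `(H ⊗ H')_ℂ` as `ℂ ⊗_ℚ (V ⊗_ℚ V')` with the reassociation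
`tensorBaseChange : ℂ ⊗ (V ⊗ V') ≃ V_ℂ ⊗_ℂ V'_ℂ` (`Motives/HodgeTensor.lean`) and `MixedHodgeStructure.tensor`,
`tensor_F`, `tensor_deligneI` (`Motives/MixedHodgeStructureTensor*.lean`). THIS FILE supplies the endomorphism side
of that dictionary, used by the limit-mixed-Hodge-structure tensor product (monodromy logarithm
`N = N₁ ⊗ 1 + 1 ⊗ N₂`, `𝔰𝔩₂`-triples, twists `e^{X₁} ⊗ e^{X₂}`):
* §1 **`HodgeStructure.tensorEnd A B`** — the endomorphism `A ⊗ B` of `ℂ ⊗ (V ⊗ V')` (Mathlib's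
  `TensorProduct.map A B` on `V_ℂ ⊗_ℂ V'_ℂ` transported along `tensorBaseChange`): multiplicativity, unit,
  (bi)additivity, powers, nilpotency, `(A ⊗ 1)(1 ⊗ B) = A ⊗ B = (1 ⊗ B)(A ⊗ 1)`, the commutator of two
  Kronecker sums `[A⊗1+1⊗A′, B⊗1+1⊗B′] = [A,B]⊗1 + 1⊗[A′,B′]`, the exponential
  **`exp(A⊗1 + 1⊗B) = e^A ⊗ e^B`** (`exp_tensorEnd_kroneckerSum`), REALITY **`conj(A ⊗ B) = Ā ⊗ B̄`**
  (`endConj_tensorEnd`), and BASE CHANGE **`(f ⊗ g)_ℂ = f_ℂ ⊗ g_ℂ`** (`baseChange_map_eq_tensorEnd`,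
  `baseChange_kroneckerSum`).
* §2 subspaces: **`(A ⊗ B)(S ⊗ U) = A S ⊗ B U`** (`map_tensorEnd_comap_map₂`), hence the action on the tensor
  filtrations — `map_tensorEnd_tensor_F_eq` (`(A ⊗ B) F^r = Σ_{a+c=r} A F^a ⊗ B F^c`), **`map_tensorEnd_tensor_F_le`**
  (if `A F^p ⊂ F^{p+a}`, `B F^p ⊂ F^{p+c}` then `(A ⊗ B) F^r ⊂ F^{r+a+c}` — Hodge II (1.1.12) for maps of degree
  `(a, c)`), `map_tensorEnd_baseChange_tensor_W_le` (the same for `W_ℂ`), and Thm. 7.5.6 / (7.6.2):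
  **`tensorEnd_mem_endPiece`** (`A ∈ 𝔤𝔩^{a,b}`, `B ∈ 𝔤𝔩^{c,d}` ⟹ `A ⊗ B ∈ 𝔤𝔩(H ⊗ H')^{a+c,b+d}`), in particular
  `A ⊗ 1 + 1 ⊗ B ∈ 𝔤𝔩(H ⊗ H')^{a,b}` for `A`, `B` of the same type.
Everything is proved; the only definition (with body) is `tensorEnd`; no instance, no named fact.

## References
* [CattaniElZeinGriffithsLe2014] E. Cattani et al. (eds.), *Hodge Theory* (2014): §3.1.1.3 (1), §3.2.2.7 (1)
  (p. 163), Thm. 7.5.6, (7.6.2).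
* [DeligneHodgeII1971] P. Deligne, *Théorie de Hodge II*, (1.1.12), 2.1.4 (the real structure / conjugation).
* [KatoUsui2009] K. Kato, S. Usui, Ann. of Math. Stud. 169, §6.1.2 (endomorphisms "defined over `ℝ`").
* [Deligne1980] P. Deligne, *La conjecture de Weil. II*, Prop. (1.6.9) (`N = N′ ⊗ 1 + 1 ⊗ N″`).
-/

noncomputable section

open scoped TensorProduct

universe u v

namespace Literature.AlgebraicGeometry.Motives

namespace HodgeStructure

variable {V : Type u} [AddCommGroup V] [Module ℚ V] {V' : Type v} [AddCommGroup V'] [Module ℚ V']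

/-! ## §1 The endomorphism `A ⊗ B` of `ℂ ⊗ (V ⊗ V')` -/

/-- **`A ⊗ B` on `(V ⊗ V')_ℂ = ℂ ⊗ (V ⊗ V')`**: the tensor product `TensorProduct.map A B` of `ℂ`-linear endomorphisms
of `V_ℂ`, `V'_ℂ`, transported along the reassociation `tensorBaseChange : ℂ ⊗ (V ⊗ V') ≃ V_ℂ ⊗_ℂ V'_ℂ`
(§3.1.1.3 (1): "`(H ⊗ H')_ℂ = H_ℂ ⊗ H'_ℂ`"). [cite: CattaniElZeinGriffithsLe2014, §3.1.1.3 (1) and §3.2.2.7 (1)] -/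
def tensorEnd (A : Module.End ℂ (ℂ ⊗[ℚ] V)) (B : Module.End ℂ (ℂ ⊗[ℚ] V')) :
    Module.End ℂ (ℂ ⊗[ℚ] (V ⊗[ℚ] V')) :=
  ((tensorBaseChange V V').symm : (ℂ ⊗[ℚ] V) ⊗[ℂ] (ℂ ⊗[ℚ] V') →ₗ[ℂ] ℂ ⊗[ℚ] (V ⊗[ℚ] V')) ∘ₗ
    TensorProduct.map A B ∘ₗ (tensorBaseChange V V' : ℂ ⊗[ℚ] (V ⊗[ℚ] V') →ₗ[ℂ] (ℂ ⊗[ℚ] V) ⊗[ℂ] (ℂ ⊗[ℚ] V'))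

section Algebra

variable (A A' : Module.End ℂ (ℂ ⊗[ℚ] V)) (B B' : Module.End ℂ (ℂ ⊗[ℚ] V'))

/-- `(A ⊗ B) x = ι⁻¹ ((A ⊗ B)(ι x))`, `ι = tensorBaseChange`. [cite: CattaniElZeinGriffithsLe2014, §3.1.1.3 (1)] -/
theorem tensorEnd_apply (x : ℂ ⊗[ℚ] (V ⊗[ℚ] V')) :
    tensorEnd A B x = (tensorBaseChange V V').symm (TensorProduct.map A B (tensorBaseChange V V' x)) := rfl

/-- `ι ((A ⊗ B) x) = (A ⊗ B)(ι x)`. [cite: CattaniElZeinGriffithsLe2014, §3.1.1.3 (1)] -/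
@[simp]
theorem tensorBaseChange_tensorEnd_apply (x : ℂ ⊗[ℚ] (V ⊗[ℚ] V')) :
    tensorBaseChange V V' (tensorEnd A B x) = TensorProduct.map A B (tensorBaseChange V V' x) := by
  rw [tensorEnd_apply, LinearEquiv.apply_symm_apply]

/-- `(A ⊗ B)(ι⁻¹(x ⊗ y)) = ι⁻¹(A x ⊗ B y)`. [cite: CattaniElZeinGriffithsLe2014, §3.1.1.3 (1)] -/
@[simp]
theorem tensorEnd_symm_tmul (x : ℂ ⊗[ℚ] V) (y : ℂ ⊗[ℚ] V') :
    tensorEnd A B ((tensorBaseChange V V').symm (x ⊗ₜ[ℂ] y)) = (tensorBaseChange V V').symm (A x ⊗ₜ[ℂ] B y) := by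
  rw [tensorEnd_apply, LinearEquiv.apply_symm_apply, TensorProduct.map_tmul]

/-- `(A ⊗ B)(c ⊗ (v ⊗ w)) = ι⁻¹(A(c ⊗ v) ⊗ B(1 ⊗ w))`. [cite: CattaniElZeinGriffithsLe2014, §3.1.1.3 (1)] -/
theorem tensorEnd_tmul (c : ℂ) (v : V) (w : V') :
    tensorEnd A B (c ⊗ₜ[ℚ] (v ⊗ₜ[ℚ] w)) =
      (tensorBaseChange V V').symm (A (c ⊗ₜ[ℚ] v) ⊗ₜ[ℂ] B ((1 : ℂ) ⊗ₜ[ℚ] w)) := by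
  rw [tensorEnd_apply, tensorBaseChange_tmul, TensorProduct.map_tmul]

/-- Two endomorphisms of `ℂ ⊗ (V ⊗ V')` agreeing on all `ι⁻¹(x ⊗ y)` are equal. [folklore] -/
private theorem ext_symm_tmul {f g : Module.End ℂ (ℂ ⊗[ℚ] (V ⊗[ℚ] V'))}
    (h : ∀ (x : ℂ ⊗[ℚ] V) (y : ℂ ⊗[ℚ] V'),
      f ((tensorBaseChange V V').symm (x ⊗ₜ[ℂ] y)) = g ((tensorBaseChange V V').symm (x ⊗ₜ[ℂ] y))) :
    f = g := by
  have hc : f ∘ₗ ((tensorBaseChange V V').symm : _ →ₗ[ℂ] ℂ ⊗[ℚ] (V ⊗[ℚ] V')) =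
      g ∘ₗ ((tensorBaseChange V V').symm : _ →ₗ[ℂ] ℂ ⊗[ℚ] (V ⊗[ℚ] V')) :=
    TensorProduct.ext' fun x y => h x y
  refine LinearMap.ext fun z => ?_
  have hz := LinearMap.congr_fun hc (tensorBaseChange V V' z)
  simpa only [LinearMap.comp_apply, LinearEquiv.coe_coe, LinearEquiv.symm_apply_apply] using hz

/-- **Multiplicativity `(A ⊗ B)(A' ⊗ B') = AA' ⊗ BB'`.** [cite: CattaniElZeinGriffithsLe2014, §3.1.1.3 (1)] -/
theorem tensorEnd_mul : tensorEnd (A * A') (B * B') = tensorEnd A B * tensorEnd A' B' :=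
  ext_symm_tmul fun x y => by
    simp only [Module.End.mul_apply, tensorEnd_symm_tmul]

/-- `1 ⊗ 1 = 1`. [cite: CattaniElZeinGriffithsLe2014, §3.1.1.3 (1)] -/
@[simp]
theorem tensorEnd_one : tensorEnd (1 : Module.End ℂ (ℂ ⊗[ℚ] V)) (1 : Module.End ℂ (ℂ ⊗[ℚ] V')) = 1 :=
  ext_symm_tmul fun x y => by
    simp only [tensorEnd_symm_tmul, Module.End.one_apply]

/-- Additivity in the first factor. [cite: CattaniElZeinGriffithsLe2014, §3.1.1.3 (1)] -/
theorem tensorEnd_add_left : tensorEnd (A + A') B = tensorEnd A B + tensorEnd A' B :=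
  ext_symm_tmul fun x y => by
    simp only [tensorEnd_symm_tmul, LinearMap.add_apply, TensorProduct.add_tmul, map_add]

/-- Additivity in the second factor. [cite: CattaniElZeinGriffithsLe2014, §3.1.1.3 (1)] -/
theorem tensorEnd_add_right : tensorEnd A (B + B') = tensorEnd A B + tensorEnd A B' :=
  ext_symm_tmul fun x y => by
    simp only [tensorEnd_symm_tmul, LinearMap.add_apply, TensorProduct.tmul_add, map_add]

/-- Homogeneity in the first factor. [cite: CattaniElZeinGriffithsLe2014, §3.1.1.3 (1)] -/
theorem tensorEnd_smul_left (c : ℂ) : tensorEnd (c • A) B = c • tensorEnd A B :=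
  ext_symm_tmul fun x y => by
    simp only [tensorEnd_symm_tmul, LinearMap.smul_apply, ← TensorProduct.smul_tmul', map_smul]

/-- Homogeneity in the second factor. [cite: CattaniElZeinGriffithsLe2014, §3.1.1.3 (1)] -/
theorem tensorEnd_smul_right (c : ℂ) : tensorEnd A (c • B) = c • tensorEnd A B :=
  ext_symm_tmul fun x y => by
    simp only [tensorEnd_symm_tmul, LinearMap.smul_apply, TensorProduct.tmul_smul, map_smul]

/-- `(-A) ⊗ B = -(A ⊗ B)`. [cite: CattaniElZeinGriffithsLe2014, §3.1.1.3 (1)] -/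
theorem tensorEnd_neg_left : tensorEnd (-A) B = -tensorEnd A B :=
  ext_symm_tmul fun x y => by
    simp only [tensorEnd_symm_tmul, LinearMap.neg_apply, TensorProduct.neg_tmul, map_neg]

/-- `A ⊗ (-B) = -(A ⊗ B)`. [cite: CattaniElZeinGriffithsLe2014, §3.1.1.3 (1)] -/
theorem tensorEnd_neg_right : tensorEnd A (-B) = -tensorEnd A B :=
  ext_symm_tmul fun x y => by
    simp only [tensorEnd_symm_tmul, LinearMap.neg_apply, TensorProduct.tmul_neg, map_neg]

/-- `(A - A') ⊗ B = A ⊗ B - A' ⊗ B`. [cite: CattaniElZeinGriffithsLe2014, §3.1.1.3 (1)] -/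
theorem tensorEnd_sub_left : tensorEnd (A - A') B = tensorEnd A B - tensorEnd A' B := by
  rw [sub_eq_add_neg, tensorEnd_add_left, tensorEnd_neg_left, ← sub_eq_add_neg]

/-- `A ⊗ (B - B') = A ⊗ B - A ⊗ B'`. [cite: CattaniElZeinGriffithsLe2014, §3.1.1.3 (1)] -/
theorem tensorEnd_sub_right : tensorEnd A (B - B') = tensorEnd A B - tensorEnd A B' := by
  rw [sub_eq_add_neg, tensorEnd_add_right, tensorEnd_neg_right, ← sub_eq_add_neg]

/-- `0 ⊗ B = 0`. [cite: CattaniElZeinGriffithsLe2014, §3.1.1.3 (1)] -/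
@[simp]
theorem tensorEnd_zero_left : tensorEnd (0 : Module.End ℂ (ℂ ⊗[ℚ] V)) B = 0 :=
  ext_symm_tmul fun x y => by
    simp only [tensorEnd_symm_tmul, LinearMap.zero_apply, TensorProduct.zero_tmul, map_zero]

/-- `A ⊗ 0 = 0`. [cite: CattaniElZeinGriffithsLe2014, §3.1.1.3 (1)] -/
@[simp]
theorem tensorEnd_zero_right : tensorEnd A (0 : Module.End ℂ (ℂ ⊗[ℚ] V')) = 0 :=
  ext_symm_tmul fun x y => by
    simp only [tensorEnd_symm_tmul, LinearMap.zero_apply, TensorProduct.tmul_zero, map_zero]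

/-- Powers: `(A ⊗ B)^n = A^n ⊗ B^n`. [cite: CattaniElZeinGriffithsLe2014, §3.1.1.3 (1)] -/
theorem tensorEnd_pow (n : ℕ) : tensorEnd A B ^ n = tensorEnd (A ^ n) (B ^ n) := by
  induction n with
  | zero => rw [pow_zero, pow_zero, pow_zero, tensorEnd_one]
  | succ n ih => rw [pow_succ, pow_succ, pow_succ, ih, tensorEnd_mul]

/-- `(A ⊗ 1)(1 ⊗ B) = A ⊗ B`. [cite: CattaniElZeinGriffithsLe2014, §3.1.1.3 (1)] -/
theorem tensorEnd_one_mul_one_tensorEnd :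
    tensorEnd A (1 : Module.End ℂ (ℂ ⊗[ℚ] V')) * tensorEnd (1 : Module.End ℂ (ℂ ⊗[ℚ] V)) B = tensorEnd A B := by
  rw [← tensorEnd_mul, mul_one, one_mul]

/-- `(1 ⊗ B)(A ⊗ 1) = A ⊗ B`. [cite: CattaniElZeinGriffithsLe2014, §3.1.1.3 (1)] -/
theorem one_tensorEnd_mul_tensorEnd_one :
    tensorEnd (1 : Module.End ℂ (ℂ ⊗[ℚ] V)) B * tensorEnd A (1 : Module.End ℂ (ℂ ⊗[ℚ] V')) = tensorEnd A B := by
  rw [← tensorEnd_mul, mul_one, one_mul]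

/-- **`A ⊗ 1` and `1 ⊗ B` commute.** [cite: CattaniElZeinGriffithsLe2014, §3.1.1.3 (1)] -/
theorem commute_tensorEnd_one_one_tensorEnd :
    Commute (tensorEnd A (1 : Module.End ℂ (ℂ ⊗[ℚ] V'))) (tensorEnd (1 : Module.End ℂ (ℂ ⊗[ℚ] V)) B) := by
  rw [Commute, SemiconjBy, tensorEnd_one_mul_one_tensorEnd, one_tensorEnd_mul_tensorEnd_one]

/-- **The commutator of two Kronecker sums: `[A⊗1 + 1⊗B, A'⊗1 + 1⊗B'] = [A,A']⊗1 + 1⊗[B,B']`** (the mixed terms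
`(A⊗1)(1⊗B') = A⊗B' = (1⊗B')(A⊗1)` cancel) — the Lie algebra of the tensor product representation.
[cite: Deligne1980, (1.6.8)–(1.6.9) (p0032)] -/
theorem kroneckerSum_commutator :
    (tensorEnd A 1 + tensorEnd 1 B) * (tensorEnd A' 1 + tensorEnd 1 B') -
        (tensorEnd A' 1 + tensorEnd 1 B') * (tensorEnd A 1 + tensorEnd 1 B) =
      tensorEnd (A * A' - A' * A) (1 : Module.End ℂ (ℂ ⊗[ℚ] V')) +
        tensorEnd (1 : Module.End ℂ (ℂ ⊗[ℚ] V)) (B * B' - B' * B) :=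
  ext_symm_tmul fun x y => by
    simp only [LinearMap.sub_apply, LinearMap.add_apply, Module.End.mul_apply, map_add, map_sub,
      tensorEnd_symm_tmul, Module.End.one_apply, TensorProduct.sub_tmul, TensorProduct.tmul_sub]
    abel

/-- `A ⊗ 1` is nilpotent if `A` is. [cite: Deligne1980, Prop. (1.6.9) (p0032)] -/
theorem isNilpotent_tensorEnd_one {A : Module.End ℂ (ℂ ⊗[ℚ] V)} (hA : IsNilpotent A) :
    IsNilpotent (tensorEnd A (1 : Module.End ℂ (ℂ ⊗[ℚ] V'))) := by
  obtain ⟨n, hn⟩ := hA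
  exact ⟨n, by rw [tensorEnd_pow, hn, one_pow, tensorEnd_zero_left]⟩

/-- `1 ⊗ B` is nilpotent if `B` is. [cite: Deligne1980, Prop. (1.6.9) (p0032)] -/
theorem isNilpotent_one_tensorEnd {B : Module.End ℂ (ℂ ⊗[ℚ] V')} (hB : IsNilpotent B) :
    IsNilpotent (tensorEnd (1 : Module.End ℂ (ℂ ⊗[ℚ] V)) B) := by
  obtain ⟨n, hn⟩ := hB
  exact ⟨n, by rw [tensorEnd_pow, hn, one_pow, tensorEnd_zero_right]⟩

/-- **The Kronecker sum `A ⊗ 1 + 1 ⊗ B` of nilpotents is nilpotent** (Deligne's `N = N′ ⊗ 1 + 1 ⊗ N″`).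
[cite: Deligne1980, Prop. (1.6.9) (p0032)] -/
theorem isNilpotent_kroneckerSum {A : Module.End ℂ (ℂ ⊗[ℚ] V)} {B : Module.End ℂ (ℂ ⊗[ℚ] V')} (hA : IsNilpotent A)
    (hB : IsNilpotent B) :
    IsNilpotent (tensorEnd A (1 : Module.End ℂ (ℂ ⊗[ℚ] V')) + tensorEnd (1 : Module.End ℂ (ℂ ⊗[ℚ] V)) B) :=
  (commute_tensorEnd_one_one_tensorEnd A B).isNilpotent_add (isNilpotent_tensorEnd_one hA)
    (isNilpotent_one_tensorEnd hB)

/-- **`exp(A ⊗ 1) = e^A ⊗ 1`** for nilpotent `A` (`A ↦ A ⊗ 1` is a ring homomorphism).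
[cite: CattaniElZeinGriffithsLe2014, §3.1.1.3 (1) and Def. 7.5.4 (`exp` of nilpotent twists)] -/
theorem exp_tensorEnd_one {A : Module.End ℂ (ℂ ⊗[ℚ] V)} (hA : IsNilpotent A) :
    IsNilpotent.exp (tensorEnd A (1 : Module.End ℂ (ℂ ⊗[ℚ] V'))) =
      tensorEnd (IsNilpotent.exp A) (1 : Module.End ℂ (ℂ ⊗[ℚ] V')) := by
  let f : Module.End ℂ (ℂ ⊗[ℚ] V) →+* Module.End ℂ (ℂ ⊗[ℚ] (V ⊗[ℚ] V')) :=
    { toFun := fun A => tensorEnd A (1 : Module.End ℂ (ℂ ⊗[ℚ] V'))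
      map_one' := tensorEnd_one
      map_mul' := fun A A' => by rw [← tensorEnd_mul, mul_one]
      map_zero' := tensorEnd_zero_left _
      map_add' := fun A A' => tensorEnd_add_left A A' 1 }
  have h := IsNilpotent.map_exp (B := Module.End ℂ (ℂ ⊗[ℚ] (V ⊗[ℚ] V'))) hA f
  simpa only [f, RingHom.coe_mk, MonoidHom.coe_mk, OneHom.coe_mk] using h.symm

/-- **`exp(1 ⊗ B) = 1 ⊗ e^B`** for nilpotent `B`. [cite: CattaniElZeinGriffithsLe2014, §3.1.1.3 (1) and Def. 7.5.4] -/
theorem exp_one_tensorEnd {B : Module.End ℂ (ℂ ⊗[ℚ] V')} (hB : IsNilpotent B) :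
    IsNilpotent.exp (tensorEnd (1 : Module.End ℂ (ℂ ⊗[ℚ] V)) B) =
      tensorEnd (1 : Module.End ℂ (ℂ ⊗[ℚ] V)) (IsNilpotent.exp B) := by
  let f : Module.End ℂ (ℂ ⊗[ℚ] V') →+* Module.End ℂ (ℂ ⊗[ℚ] (V ⊗[ℚ] V')) :=
    { toFun := fun B => tensorEnd (1 : Module.End ℂ (ℂ ⊗[ℚ] V)) B
      map_one' := tensorEnd_one
      map_mul' := fun B B' => by rw [← tensorEnd_mul, mul_one]
      map_zero' := tensorEnd_zero_right _
      map_add' := fun B B' => tensorEnd_add_right 1 B B' }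
  have h := IsNilpotent.map_exp (B := Module.End ℂ (ℂ ⊗[ℚ] (V ⊗[ℚ] V'))) hB f
  simpa only [f, RingHom.coe_mk, MonoidHom.coe_mk, OneHom.coe_mk] using h.symm

/-- **`exp(A ⊗ 1 + 1 ⊗ B) = e^A ⊗ e^B`** for nilpotent `A`, `B` (the two summands commute): the exponential of a
Kronecker sum is the tensor product of the exponentials — e.g. `e^{z(N₁⊗1+1⊗N₂)} = e^{zN₁} ⊗ e^{zN₂}` along a
nilpotent orbit. [cite: CattaniElZeinGriffithsLe2014, §3.1.1.3 (1) and Def. 7.5.4] [cite: Deligne1980, Prop. (1.6.9) (p0032)] -/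
theorem exp_tensorEnd_kroneckerSum {A : Module.End ℂ (ℂ ⊗[ℚ] V)} {B : Module.End ℂ (ℂ ⊗[ℚ] V')}
    (hA : IsNilpotent A) (hB : IsNilpotent B) :
    IsNilpotent.exp (tensorEnd A (1 : Module.End ℂ (ℂ ⊗[ℚ] V')) + tensorEnd (1 : Module.End ℂ (ℂ ⊗[ℚ] V)) B) =
      tensorEnd (IsNilpotent.exp A) (IsNilpotent.exp B) := by
  rw [IsNilpotent.exp_add_of_commute (commute_tensorEnd_one_one_tensorEnd A B) (isNilpotent_tensorEnd_one hA)
    (isNilpotent_one_tensorEnd hB), exp_tensorEnd_one hA, exp_one_tensorEnd hB, tensorEnd_one_mul_one_tensorEnd]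

/-- **Reality: `conj(A ⊗ B) = Ā ⊗ B̄`** — complex conjugation of endomorphisms (`endConj T = conj ∘ T ∘ conj`, the
real structure `End(V_ℂ) = End(V_ℝ) ⊗ ℂ`) is compatible with `⊗`, since `conj(x ⊗ y) = conj x ⊗ conj y` on
`(V ⊗ V')_ℂ`. In particular `A ⊗ B` is defined over `ℝ` when `A` and `B` are.
[cite: DeligneHodgeII1971, 2.1.4] [cite: KatoUsui2009, §6.1.2] -/
theorem endConj_tensorEnd : endConj (tensorEnd A B) = tensorEnd (endConj A) (endConj B) :=
  ext_symm_tmul fun x y => by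
    rw [endConj_apply, conj_tensorBaseChange_symm_tmul, tensorEnd_symm_tmul, conj_tensorBaseChange_symm_tmul,
      tensorEnd_symm_tmul, endConj_apply, endConj_apply]

/-- `A ⊗ B` is real if `A` and `B` are. [cite: KatoUsui2009, §6.1.2] -/
theorem endConj_tensorEnd_of_eq {A : Module.End ℂ (ℂ ⊗[ℚ] V)} {B : Module.End ℂ (ℂ ⊗[ℚ] V')} (hA : endConj A = A)
    (hB : endConj B = B) : endConj (tensorEnd A B) = tensorEnd A B := by
  rw [endConj_tensorEnd, hA, hB]

end Algebra

/-! ### Base change: `(f ⊗ g)_ℂ = f_ℂ ⊗ g_ℂ` -/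

section BaseChange

/-- **`(f ⊗ g)_ℂ = f_ℂ ⊗ g_ℂ`**: the complexification of `TensorProduct.map f g : V ⊗ V' → V ⊗ V'` is `f_ℂ ⊗ g_ℂ`
under the identification `(V ⊗ V')_ℂ = V_ℂ ⊗ V'_ℂ` (extension of scalars commutes with `⊗`).
[cite: CattaniElZeinGriffithsLe2014, §3.1.1.3 (1)] [cite: DeligneHodgeII1971, (1.1.12)] -/
theorem baseChange_map_eq_tensorEnd (f : V →ₗ[ℚ] V) (g : V' →ₗ[ℚ] V') :
    (TensorProduct.map f g).baseChange ℂ = tensorEnd (f.baseChange ℂ) (g.baseChange ℂ) := by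
  refine LinearMap.ext fun x => ?_
  rw [tensorEnd_apply, LinearEquiv.eq_symm_apply]
  induction x using TensorProduct.induction_on with
  | zero => simp only [map_zero]
  | add x y hx hy => simp only [map_add, hx, hy]
  | tmul c z =>
    induction z using TensorProduct.induction_on with
    | zero => simp only [TensorProduct.tmul_zero, map_zero]
    | add x y hx hy => simp only [TensorProduct.tmul_add, map_add, hx, hy]
    | tmul v w =>
      simp only [LinearMap.baseChange_tmul, TensorProduct.map_tmul, tensorBaseChange_tmul]

/-- `(1_V)_ℂ = 1`. [folklore] -/
private theorem baseChange_one : (1 : Module.End ℚ V).baseChange ℂ = (1 : Module.End ℂ (ℂ ⊗[ℚ] V)) := by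
  rw [Module.End.one_eq_id, LinearMap.baseChange_id, Module.End.one_eq_id]

/-- **`(N₁ ⊗ 1 + 1 ⊗ N₂)_ℂ = N₁,ℂ ⊗ 1 + 1 ⊗ N₂,ℂ`** (Deligne's `N = N′ ⊗ 1 + 1 ⊗ N″`, complexified).
[cite: Deligne1980, Prop. (1.6.9) (p0032)] [cite: CattaniElZeinGriffithsLe2014, §3.1.1.3 (1)] -/
theorem baseChange_kroneckerSum (N₁ : V →ₗ[ℚ] V) (N₂ : V' →ₗ[ℚ] V') :
    (TensorProduct.map N₁ (1 : Module.End ℚ V') + TensorProduct.map (1 : Module.End ℚ V) N₂).baseChange ℂ =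
      tensorEnd (N₁.baseChange ℂ) (1 : Module.End ℂ (ℂ ⊗[ℚ] V')) +
        tensorEnd (1 : Module.End ℂ (ℂ ⊗[ℚ] V)) (N₂.baseChange ℂ) := by
  rw [LinearMap.baseChange_add, baseChange_map_eq_tensorEnd, baseChange_map_eq_tensorEnd, baseChange_one,
    baseChange_one]

end BaseChange

/-! ## §2 Subspaces: `(A ⊗ B)(S ⊗ U) = AS ⊗ BU`, the tensor filtrations, and `𝔤𝔩(H ⊗ H')^{a,b}` -/

section Subspaces

variable (A : Module.End ℂ (ℂ ⊗[ℚ] V)) (B : Module.End ℂ (ℂ ⊗[ℚ] V'))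

/-- `(A ⊗ B)(S ⊗ U) = A S ⊗ B U` inside `V_ℂ ⊗_ℂ V'_ℂ` (both are the span of the `A x ⊗ B y`). [folklore] -/
private theorem map_map_map₂_mk (S : Submodule ℂ (ℂ ⊗[ℚ] V)) (U : Submodule ℂ (ℂ ⊗[ℚ] V')) :
    (Submodule.map₂ (TensorProduct.mk ℂ (ℂ ⊗[ℚ] V) (ℂ ⊗[ℚ] V')) S U).map (TensorProduct.map A B) =
      Submodule.map₂ (TensorProduct.mk ℂ (ℂ ⊗[ℚ] V) (ℂ ⊗[ℚ] V')) (S.map A) (U.map B) := by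
  rw [Submodule.map₂_eq_span_image2, Submodule.map₂_eq_span_image2, Submodule.map_span, Submodule.map_coe,
    Submodule.map_coe, Set.image_image2, Set.image2_image_left, Set.image2_image_right]
  simp only [TensorProduct.mk_apply, TensorProduct.map_tmul]

/-- **`(A ⊗ B)(S ⊗ U) = A S ⊗ B U`** for subspaces `S ⊂ V_ℂ`, `U ⊂ V'_ℂ` (pulled back to `ℂ ⊗ (V ⊗ V')`): the image
of the span of the `x ⊗ y` is the span of the `A x ⊗ B y`. [cite: DeligneHodgeII1971, (1.1.12)]
[cite: CattaniElZeinGriffithsLe2014, §3.2.2.7 (1)] -/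
theorem map_tensorEnd_comap_map₂ (S : Submodule ℂ (ℂ ⊗[ℚ] V)) (U : Submodule ℂ (ℂ ⊗[ℚ] V')) :
    ((Submodule.map₂ (TensorProduct.mk ℂ (ℂ ⊗[ℚ] V) (ℂ ⊗[ℚ] V')) S U).comap
        (tensorBaseChange V V' : ℂ ⊗[ℚ] (V ⊗[ℚ] V') →ₗ[ℂ] _)).map (tensorEnd A B) =
      (Submodule.map₂ (TensorProduct.mk ℂ (ℂ ⊗[ℚ] V) (ℂ ⊗[ℚ] V')) (S.map A) (U.map B)).comap
        (tensorBaseChange V V' : ℂ ⊗[ℚ] (V ⊗[ℚ] V') →ₗ[ℂ] _) := by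
  rw [Submodule.comap_equiv_eq_map_symm, Submodule.comap_equiv_eq_map_symm, ← map_map_map₂_mk,
    ← Submodule.map_comp, ← Submodule.map_comp]
  congr 1
  refine LinearMap.ext fun z => ?_
  simp only [LinearMap.comp_apply, LinearEquiv.coe_coe, tensorEnd_apply, LinearEquiv.apply_symm_apply]

variable [FiniteDimensional ℚ V] [FiniteDimensional ℚ V'] (H₁ : MixedHodgeStructure V) (H₂ : MixedHodgeStructure V')

/-- **`(A ⊗ B) F^r(H₁ ⊗ H₂) = Σ_{a+c=r} A F^a ⊗ B F^c`.** [cite: CattaniElZeinGriffithsLe2014, §3.2.2.7 (1)(iii)]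
[cite: DeligneHodgeII1971, (1.1.12)] -/
theorem map_tensorEnd_tensor_F_eq (r : ℤ) :
    ((MixedHodgeStructure.tensor H₁ H₂).F r).map (tensorEnd A B) =
      ⨆ ac ∈ {ac : ℤ × ℤ | ac.1 + ac.2 = r},
        (Submodule.map₂ (TensorProduct.mk ℂ (ℂ ⊗[ℚ] V) (ℂ ⊗[ℚ] V')) ((H₁.F ac.1).map A) ((H₂.F ac.2).map B)).comap
          (tensorBaseChange V V' : ℂ ⊗[ℚ] (V ⊗[ℚ] V') →ₗ[ℂ] _) := by
  rw [MixedHodgeStructure.tensor_F]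
  simp only [Submodule.map_iSup, map_tensorEnd_comap_map₂]

/-- **Hodge II (1.1.12) for maps of bidegree `(a, c)`: if `A F^p ⊂ F^{p+a}` and `B F^p ⊂ F^{p+c}` then
`(A ⊗ B) F^r(H₁ ⊗ H₂) ⊂ F^{r+a+c}(H₁ ⊗ H₂)`** (e.g. `N ⊗ 1`, `1 ⊗ N` lower `F` by one when `N` does).
[cite: DeligneHodgeII1971, (1.1.12)] [cite: CattaniElZeinGriffithsLe2014, §3.2.2.7 (1)(iii)] -/
theorem map_tensorEnd_tensor_F_le {a c : ℤ} (hA : ∀ p, (H₁.F p).map A ≤ H₁.F (p + a))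
    (hB : ∀ p, (H₂.F p).map B ≤ H₂.F (p + c)) (r : ℤ) :
    ((MixedHodgeStructure.tensor H₁ H₂).F r).map (tensorEnd A B) ≤
      (MixedHodgeStructure.tensor H₁ H₂).F (r + a + c) := by
  rw [map_tensorEnd_tensor_F_eq, MixedHodgeStructure.tensor_F]
  refine iSup₂_le fun ac hac => ?_
  have hac' : ac.1 + ac.2 = r := hac
  refine (Submodule.comap_mono (Submodule.map₂_le_map₂ (hA ac.1) (hB ac.2))).trans ?_
  exact le_biSup (fun ac : ℤ × ℤ => (Submodule.map₂ (TensorProduct.mk ℂ (ℂ ⊗[ℚ] V) (ℂ ⊗[ℚ] V'))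
      (H₁.F ac.1) (H₂.F ac.2)).comap (tensorBaseChange V V' : ℂ ⊗[ℚ] (V ⊗[ℚ] V') →ₗ[ℂ] _))
    (i := (ac.1 + a, ac.2 + c)) (show ac.1 + a + (ac.2 + c) = r + a + c by omega)

/-- **The same for the weight filtration: if `A W_{i,ℂ} ⊂ W_{i+a,ℂ}` and `B W_{j,ℂ} ⊂ W_{j+c,ℂ}` then
`(A ⊗ B) W_n(H₁ ⊗ H₂)_ℂ ⊂ W_{n+a+c}(H₁ ⊗ H₂)_ℂ`** (e.g. elements of `W_{−1} End` such as Deligne's `δ`, or `N`,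
act on `W(H₁ ⊗ H₂)` with the same shift). [cite: DeligneHodgeII1971, (1.1.12)]
[cite: CattaniElZeinGriffithsLe2014, §3.2.2.7 (1)(ii)] -/
theorem map_tensorEnd_baseChange_tensor_W_le {a c : ℤ}
    (hA : ∀ i, ((H₁.W i).baseChange ℂ).map A ≤ (H₁.W (i + a)).baseChange ℂ)
    (hB : ∀ j, ((H₂.W j).baseChange ℂ).map B ≤ (H₂.W (j + c)).baseChange ℂ) (n : ℤ) :
    (((MixedHodgeStructure.tensor H₁ H₂).W n).baseChange ℂ).map (tensorEnd A B) ≤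
      ((MixedHodgeStructure.tensor H₁ H₂).W (n + a + c)).baseChange ℂ := by
  rw [MixedHodgeStructure.tensor_W, MixedHodgeStructure.tensor_W,
    Literature.LinearAlgebra.BaseChange.baseChange_iSup, Literature.LinearAlgebra.BaseChange.baseChange_iSup]
  simp only [Literature.LinearAlgebra.BaseChange.baseChange_iSup, Submodule.map_iSup,
    MixedHodgeStructure.baseChange_map₂_mk, map_tensorEnd_comap_map₂]
  refine iSup₂_le fun ij hij => ?_
  have hij' : ij.1 + ij.2 = n := hij
  refine (Submodule.comap_mono (Submodule.map₂_le_map₂ (hA ij.1) (hB ij.2))).trans ?_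
  exact le_biSup (fun ij : ℤ × ℤ => (Submodule.map₂ (TensorProduct.mk ℂ (ℂ ⊗[ℚ] V) (ℂ ⊗[ℚ] V'))
      ((H₁.W ij.1).baseChange ℂ) ((H₂.W ij.2).baseChange ℂ)).comap
        (tensorBaseChange V V' : ℂ ⊗[ℚ] (V ⊗[ℚ] V') →ₗ[ℂ] _))
    (i := (ij.1 + a, ij.2 + c)) (show ij.1 + a + (ij.2 + c) = n + a + c by omega)

omit [FiniteDimensional ℚ V] [FiniteDimensional ℚ V'] in
/-- `(A ⊗ B)(I^{a',b'}(H₁) ⊗ I^{c',d'}(H₂)) ⊂ I^{a'+a,b'+b}(H₁) ⊗ I^{c'+c,d'+d}(H₂)` for `A ∈ 𝔤𝔩(V)^{a,b}`,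
`B ∈ 𝔤𝔩(V')^{c,d}`. [cite: CattaniElZeinGriffithsLe2014, Thm. 7.5.6 and (7.6.2)] -/
theorem map_tensorEnd_tensorPiece_le {a b c d : ℤ} (hA : A ∈ H₁.endPiece a b) (hB : B ∈ H₂.endPiece c d)
    (α β : ℤ × ℤ) :
    (MixedHodgeStructure.tensorPiece H₁ H₂ (α, β)).map (tensorEnd A B) ≤
      MixedHodgeStructure.tensorPiece H₁ H₂ ((α.1 + a, α.2 + b), (β.1 + c, β.2 + d)) := by
  rw [MixedHodgeStructure.tensorPiece, MixedHodgeStructure.tensorPiece, map_tensorEnd_comap_map₂]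
  exact Submodule.comap_mono (Submodule.map₂_le_map₂ (hA α.1 α.2) (hB β.1 β.2))

/-- **Thm. 7.5.6 / (7.6.2) for endomorphisms: `A ∈ 𝔤𝔩(V)^{a,b}`, `B ∈ 𝔤𝔩(V')^{c,d}` ⟹
`A ⊗ B ∈ 𝔤𝔩(H₁ ⊗ H₂)^{a+c,b+d}`** — Deligne's bigrading of `H₁ ⊗ H₂` is `I^{p,q} = ⊕ I^{a',b'}(H₁) ⊗ I^{c',d'}(H₂)`
(`MixedHodgeStructure.tensor_deligneI`), and `A ⊗ B` shifts each summand by `(a+c, b+d)`.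
[cite: CattaniElZeinGriffithsLe2014, Thm. 7.5.6 and (7.6.2)] -/
theorem tensorEnd_mem_endPiece {a b c d : ℤ} (hA : A ∈ H₁.endPiece a b) (hB : B ∈ H₂.endPiece c d) :
    tensorEnd A B ∈ (MixedHodgeStructure.tensor H₁ H₂).endPiece (a + c) (b + d) := by
  intro p q
  rw [MixedHodgeStructure.tensor_deligneI, MixedHodgeStructure.tensor_deligneI, MixedHodgeStructure.tensorBigrading,
    MixedHodgeStructure.tensorBigrading]
  simp only [Submodule.map_iSup]
  refine iSup₂_le fun αβ hαβ => ?_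
  have h1 : αβ.1.1 + αβ.2.1 = p := congrArg Prod.fst hαβ
  have h2 : αβ.1.2 + αβ.2.2 = q := congrArg Prod.snd hαβ
  refine (map_tensorEnd_tensorPiece_le A B H₁ H₂ hA hB αβ.1 αβ.2).trans ?_
  exact le_biSup (MixedHodgeStructure.tensorPiece H₁ H₂) (i := ((αβ.1.1 + a, αβ.1.2 + b), (αβ.2.1 + c, αβ.2.2 + d)))
    (show (αβ.1.1 + a + (αβ.2.1 + c), αβ.1.2 + b + (αβ.2.2 + d)) = (p + (a + c), q + (b + d)) by
      rw [Prod.mk.injEq]; constructor <;> omega)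

/-- `A ⊗ 1 ∈ 𝔤𝔩(H₁ ⊗ H₂)^{a,b}` for `A ∈ 𝔤𝔩(V)^{a,b}`. [cite: CattaniElZeinGriffithsLe2014, Thm. 7.5.6 and (7.6.2)] -/
theorem tensorEnd_one_mem_endPiece {a b : ℤ} (hA : A ∈ H₁.endPiece a b) :
    tensorEnd A (1 : Module.End ℂ (ℂ ⊗[ℚ] V')) ∈ (MixedHodgeStructure.tensor H₁ H₂).endPiece a b := by
  have h := tensorEnd_mem_endPiece A 1 H₁ H₂ hA H₂.one_mem_endPiece_zero
  rwa [add_zero, add_zero] at h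

/-- `1 ⊗ B ∈ 𝔤𝔩(H₁ ⊗ H₂)^{c,d}` for `B ∈ 𝔤𝔩(V')^{c,d}`. [cite: CattaniElZeinGriffithsLe2014, Thm. 7.5.6 and (7.6.2)] -/
theorem one_tensorEnd_mem_endPiece {c d : ℤ} (hB : B ∈ H₂.endPiece c d) :
    tensorEnd (1 : Module.End ℂ (ℂ ⊗[ℚ] V)) B ∈ (MixedHodgeStructure.tensor H₁ H₂).endPiece c d := by
  have h := tensorEnd_mem_endPiece 1 B H₁ H₂ H₁.one_mem_endPiece_zero hB
  rwa [zero_add, zero_add] at h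

/-- **The Kronecker sum `A ⊗ 1 + 1 ⊗ B ∈ 𝔤𝔩(H₁ ⊗ H₂)^{a,b}` for `A ∈ 𝔤𝔩(V)^{a,b}`, `B ∈ 𝔤𝔩(V')^{a,b}`** — e.g. the
monodromy logarithm `N₁ ⊗ 1 + 1 ⊗ N₂` is again a `(−1,−1)`-morphism, and the images of `𝐲`, `𝐧₊` under a tensor
product of Hodge representations have the bidegrees of the factors. [cite: CattaniElZeinGriffithsLe2014, Thm. 7.5.6 and (7.6.2)] -/
theorem kroneckerSum_mem_endPiece {a b : ℤ} (hA : A ∈ H₁.endPiece a b) (hB : B ∈ H₂.endPiece a b) :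
    tensorEnd A (1 : Module.End ℂ (ℂ ⊗[ℚ] V')) + tensorEnd (1 : Module.End ℂ (ℂ ⊗[ℚ] V)) B ∈
      (MixedHodgeStructure.tensor H₁ H₂).endPiece a b :=
  Submodule.add_mem _ (tensorEnd_one_mem_endPiece A H₁ H₂ hA) (one_tensorEnd_mem_endPiece B H₁ H₂ hB)

end Subspaces

end HodgeStructure

end Literature.AlgebraicGeometry.Motives

end
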